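import Literature.Analysis.FluidPDE.SpaceTimeUniformLimit
import HarnessLib

/-!
# The distributional Euler equations pass to uniform limits of Euler–Reynolds-type
# approximations (De Lellis–Kwon 2022, §2.2; BDSV 2019, §2.2)

Support file (theorem-only) for the named fact `Torus.DeLellisKwon2022_thm11`
(`GloballyDissipativeEuler`), first half of the passage to the limit in the printed proof of
De Lellis–Kwon, Anal. PDE 15 (2022) = arXiv:2006.06482, Thm. 1.1 (§2.2: "Since `(R_q, κ_q, φ_q)`
converges to `0` in `C⁰([0,T] × T³)`, the limit `(v,p)` solves the Euler equation"): if
continuous fields `(v_q, p_q, R_q)` on `[0,T] × T^d` satisfy the **pressure-explicit** tested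
momentum identity with Reynolds defect,
`∫₀ᵀ∫ (⟪v_q, ∂ₜψ⟫ + ⟪v_q, (v_q·∇)ψ⟫ + p_q div ψ) = ∫₀ᵀ∫ ∑ⱼ ⟪R_q^{(j)}, ∂ⱼψ⟫` for all smooth
vector tests `ψ` compactly supported in `(0,T)` (for smooth Euler–Reynolds flows this is
integration by parts), and `v_q → u`, `p_q → P` uniformly, `‖R_q‖₀ → 0`, then `(u, P)` solves the
distributional momentum equation (`Torus.momentum_of_unifLimit`), and weak incompressibility
passes to the limit (`Torus.isWeaklyDivFree_of_unifLimit`). The pressure-free version for smooth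
Euler–Reynolds flows is the tree's `Torus.isWeakEulerSolutionOn_of_unifLimit` (`EulerReynolds`);
the bookkeeping is that of `SpaceTimeUniformLimit`. The local energy balance of the limit is in
`GloballyDissipativeEulerLimit`.

## References

* C. De Lellis, H. Kwon, Anal. PDE 15 (2022) 2003–2059 = arXiv:2006.06482, §2.2.
  [DelellisKwon2022]
* T. Buckmaster, C. De Lellis, L. Székelyhidi Jr., V. Vicol, CPAM 72 (2019), §2.2.
  [BuckmasterEtAl2018]
-/

noncomputable section

open MeasureTheory Set Filter Function
open scoped InnerProductSpace RealInnerProductSpace ENNReal NNReal Topology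

namespace Literature.Analysis.FluidPDE.Torus

/-- Continuity of the space–time lift of the pressure-explicit weak-Euler integrand
`⟪w, ∂ₜψ⟫ + ⟪w, ∑ᵢ wᵢ ∂ᵢψ⟫ + r div ψ` for fields `w, r` with continuous lifts and a test field `ψ`. [folklore] -/
theorem continuousOn_stLift_momentumIntegrand {d : Type*} [Fintype d] [DecidableEq d] {T : ℝ}
    (hT : 0 < T) {ψ : ℝ → UnitAddTorus d → EuclideanSpace ℝ d} (hψ : FunctionSpaces.Torus.IsSpaceTimeTestIoo T ψ)
    {w : ℝ → UnitAddTorus d → EuclideanSpace ℝ d} {r : ℝ → UnitAddTorus d → ℝ}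
    (hw : ContinuousOn (FunctionSpaces.Torus.stLift w) (Icc 0 T ×ˢ univ)) (hr : ContinuousOn (FunctionSpaces.Torus.stLift r) (Icc 0 T ×ˢ univ)) :
    ContinuousOn (FunctionSpaces.Torus.stLift fun t x => ⟪w t x, FunctionSpaces.Torus.timeDeriv ψ t x⟫_ℝ +
      ⟪w t x, ∑ i, w t x i • FunctionSpaces.Torus.partialDeriv i (ψ t) x⟫_ℝ + r t x * FunctionSpaces.Torus.divergence (ψ t) x)
      (Icc 0 T ×ˢ univ) := by
  have hU : UniqueDiffOn ℝ (Icc 0 T) := uniqueDiffOn_Icc hT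
  have hψI : FunctionSpaces.Torus.IsSmoothSpaceTimeOn (Icc 0 T) ψ := hψ.1.1.contDiffOn
  have hψ'c : ContinuousOn (FunctionSpaces.Torus.stLift (FunctionSpaces.Torus.timeDeriv ψ)) (Icc 0 T ×ˢ univ) :=
    hψ.1.timeDeriv.1.continuous.continuousOn
  have hsum : ContinuousOn (FunctionSpaces.Torus.stLift fun t x => ∑ i, w t x i • FunctionSpaces.Torus.partialDeriv i (ψ t) x)
      (Icc 0 T ×ˢ univ) :=
    continuousOn_stLift_sum Finset.univ fun i _ =>
      FunctionSpaces.Torus.continuousOn_stLift_comp₂ hw ((hψI.partialDeriv hU i).continuousOn_stLift)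
        (Φ := fun a b => a i • b)
        (((EuclideanSpace.proj i).continuous.comp continuous_fst).smul continuous_snd)
  exact FunctionSpaces.Torus.continuousOn_stLift_comp₂
    (FunctionSpaces.Torus.continuousOn_stLift_comp₂ (FunctionSpaces.Torus.continuousOn_stLift_comp₂ hw hψ'c (Φ := fun a b => ⟪a, b⟫_ℝ)
      continuous_inner) (FunctionSpaces.Torus.continuousOn_stLift_comp₂ hw hsum (Φ := fun a b => ⟪a, b⟫_ℝ)
      continuous_inner) (Φ := fun a b => a + b) continuous_add)
    (FunctionSpaces.Torus.continuousOn_stLift_comp₂ hr ((hψI.divergence hU).continuousOn_stLift)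
      (Φ := fun a b => a * b) continuous_mul) (Φ := fun a b => a + b) continuous_add

variable {d : Type*} [Fintype d] [DecidableEq d]

omit [Fintype d] [DecidableEq d] in
/-- Columns of a tensor field with continuous space–time lift have continuous lifts. [folklore] -/
theorem continuousOn_stLift_column {S : Set ℝ} {R : ℝ → UnitAddTorus d → d → EuclideanSpace ℝ d}
    (hR : ContinuousOn (FunctionSpaces.Torus.stLift R) (S ×ˢ univ)) (j : d) :
    ContinuousOn (FunctionSpaces.Torus.stLift fun t x => R t x j) (S ×ˢ univ) :=
  (ContinuousLinearMap.proj (R := ℝ) (φ := fun _ : d => EuclideanSpace ℝ d) j).continuous.comp_continuousOn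
    hR

/-- **The distributional momentum equation passes to uniform limits** (De Lellis–Kwon 2022,
§2.2; BDSV 2019, §2.2). If continuous fields `(v_q, p_q, R_q)` on `[0,T] × T^d` satisfy the
pressure-explicit tested momentum identity
`∫₀ᵀ∫ (⟪v_q, ∂ₜψ⟫ + ⟪v_q, (v_q·∇)ψ⟫ + p_q div ψ) = ∫₀ᵀ∫ ∑ⱼ ⟪R_q^{(j)}, ∂ⱼψ⟫` for every smooth
vector test field `ψ` compactly supported in `(0,T)`, and `v_q → u`, `p_q → P` uniformly while
`‖R_q‖₀ → 0`, then `∫₀ᵀ∫ (⟪u, ∂ₜψ⟫ + ⟪u, (u·∇)ψ⟫ + P div ψ) = 0`. [cite: DelellisKwon2022, §2.2] -/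
theorem momentum_of_unifLimit {T : ℝ} (hT : 0 < T)
    {v : ℕ → ℝ → UnitAddTorus d → EuclideanSpace ℝ d} {p : ℕ → ℝ → UnitAddTorus d → ℝ}
    {R : ℕ → ℝ → UnitAddTorus d → d → EuclideanSpace ℝ d}
    {u : ℝ → UnitAddTorus d → EuclideanSpace ℝ d} {P : ℝ → UnitAddTorus d → ℝ}
    (hvc : ∀ q, ContinuousOn (FunctionSpaces.Torus.stLift (v q)) (Icc 0 T ×ˢ univ))
    (hpc : ∀ q, ContinuousOn (FunctionSpaces.Torus.stLift (p q)) (Icc 0 T ×ˢ univ))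
    (hRc : ∀ q, ContinuousOn (FunctionSpaces.Torus.stLift (R q)) (Icc 0 T ×ˢ univ))
    (hmom : ∀ q, ∀ ψ : ℝ → UnitAddTorus d → EuclideanSpace ℝ d, FunctionSpaces.Torus.IsSpaceTimeTestIoo T ψ →
      ∫ t in Ioo 0 T, ∫ x, (⟪v q t x, FunctionSpaces.Torus.timeDeriv ψ t x⟫_ℝ +
          ⟪v q t x, FunctionSpaces.Torus.convect (v q t) (ψ t) x⟫_ℝ + p q t x * FunctionSpaces.Torus.divergence (ψ t) x) =
        ∫ t in Ioo 0 T, ∫ x, ∑ j, ⟪R q t x j, FunctionSpaces.Torus.partialDeriv j (ψ t) x⟫_ℝ)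
    (hv : ∀ ε > (0 : ℝ), ∃ N : ℕ, ∀ q ≥ N, ∀ t ∈ Icc 0 T, ∀ x, ‖v q t x - u t x‖ ≤ ε)
    (hp : ∀ ε > (0 : ℝ), ∃ N : ℕ, ∀ q ≥ N, ∀ t ∈ Icc 0 T, ∀ x, ‖p q t x - P t x‖ ≤ ε)
    (hR : ∀ ε > (0 : ℝ), ∃ N : ℕ, ∀ q ≥ N, ∀ t ∈ Icc 0 T, ∀ x, ‖R q t x‖ ≤ ε)
    {ψ : ℝ → UnitAddTorus d → EuclideanSpace ℝ d} (hψ : FunctionSpaces.Torus.IsSpaceTimeTestIoo T ψ) :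
    ∫ t in Ioo 0 T, ∫ x, (⟪u t x, FunctionSpaces.Torus.timeDeriv ψ t x⟫_ℝ + ⟪u t x, FunctionSpaces.Torus.convect (u t) (ψ t) x⟫_ℝ +
      P t x * FunctionSpaces.Torus.divergence (ψ t) x) = 0 := by
  have hU : UniqueDiffOn ℝ (Icc 0 T) := uniqueDiffOn_Icc hT
  have huc : ContinuousOn (FunctionSpaces.Torus.stLift u) (Icc 0 T ×ˢ univ) := continuousOn_stLift_of_unifLimit hvc hv
  have hPc : ContinuousOn (FunctionSpaces.Torus.stLift P) (Icc 0 T ×ˢ univ) := continuousOn_stLift_of_unifLimit hpc hp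
  obtain ⟨C, hC⟩ := FunctionSpaces.Torus.exists_norm_le_of_continuousOn_of_isCompact huc isCompact_Icc subset_rfl
  have hC0 : 0 ≤ C := (norm_nonneg _).trans (hC 0 ⟨le_rfl, hT.le⟩ 0)
  obtain ⟨CP, hCP⟩ := FunctionSpaces.Torus.exists_norm_le_of_continuousOn_of_isCompact hPc isCompact_Icc subset_rfl
  -- test-field data
  have hψI : FunctionSpaces.Torus.IsSmoothSpaceTimeOn (Icc 0 T) ψ := hψ.1.1.contDiffOn
  have hψ'c : ContinuousOn (FunctionSpaces.Torus.stLift (FunctionSpaces.Torus.timeDeriv ψ)) (Icc 0 T ×ˢ univ) :=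
    hψ.1.timeDeriv.1.continuous.continuousOn
  have hDψ : ∀ j, FunctionSpaces.Torus.IsSmoothSpaceTimeOn (Icc 0 T) (fun t => FunctionSpaces.Torus.partialDeriv j (ψ t)) := fun j =>
    hψI.partialDeriv hU j
  have hdivψ : FunctionSpaces.Torus.IsSmoothSpaceTimeOn (Icc 0 T) (fun t => FunctionSpaces.Torus.divergence (ψ t)) := hψI.divergence hU
  obtain ⟨K₁, hK₁⟩ := FunctionSpaces.Torus.exists_norm_le_of_continuousOn_of_isCompact hψ'c isCompact_Icc subset_rfl
  choose K₂ hK₂ using fun j => (hDψ j).exists_norm_le_of_isCompact isCompact_Icc subset_rfl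
  obtain ⟨K₃, hK₃⟩ := hdivψ.exists_norm_le_of_isCompact isCompact_Icc subset_rfl
  have hconv : ∀ (w : UnitAddTorus d → EuclideanSpace ℝ d) (t : ℝ) (x : UnitAddTorus d),
      FunctionSpaces.Torus.convect w (ψ t) x = ∑ i, w x i • FunctionSpaces.Torus.partialDeriv i (ψ t) x := fun w t x =>
    FunctionSpaces.Torus.fderiv_apply_eq_sum_partialDeriv ((hψ.1.isSmooth_slice t).isContDiff (by simp)) x (w x)
  -- uniform convergence of the left integrand (in coordinates)
  have hsum : ∀ ε > (0 : ℝ), ∃ N : ℕ, ∀ q ≥ N, ∀ t ∈ Icc 0 T, ∀ x,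
      ‖(∑ i, v q t x i • FunctionSpaces.Torus.partialDeriv i (ψ t) x) - ∑ i, u t x i • FunctionSpaces.Torus.partialDeriv i (ψ t) x‖ ≤ ε :=
    unifTo_sum Finset.univ fun i _ =>
      unifTo_smul (unifTo_apply hv i) (unifTo_const fun t x => FunctionSpaces.Torus.partialDeriv i (ψ t) x)
        (fun t ht x => (PiLp.norm_apply_le (u t x) i).trans (hC t ht x)) (hK₂ i)
  have hsumb : ∀ t ∈ Icc 0 T, ∀ x, ‖∑ i, u t x i • FunctionSpaces.Torus.partialDeriv i (ψ t) x‖ ≤ ∑ i, C * K₂ i := by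
    intro t ht x
    refine (norm_sum_le _ _).trans (Finset.sum_le_sum fun i _ => ?_)
    rw [norm_smul]
    exact mul_le_mul ((PiLp.norm_apply_le (u t x) i).trans (hC t ht x)) (hK₂ i t ht x)
      (norm_nonneg _) hC0
  have hg := unifTo_add (unifTo_add (unifTo_inner hv (unifTo_const (FunctionSpaces.Torus.timeDeriv ψ)) hC hK₁)
    (unifTo_inner hv hsum hC hsumb)) (unifTo_mul hp (unifTo_const fun t x => FunctionSpaces.Torus.divergence (ψ t) x)
    hCP hK₃)
  -- the Reynolds defect integrand tends to zero uniformly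
  have hh₀ : ∀ ε > (0 : ℝ), ∃ N : ℕ, ∀ q ≥ N, ∀ t ∈ Icc 0 T, ∀ x,
      ‖(∑ j, ⟪R q t x j, FunctionSpaces.Torus.partialDeriv j (ψ t) x⟫_ℝ) -
        ∑ j, (0 : ℝ → UnitAddTorus d → ℝ) t x‖ ≤ ε :=
    unifTo_sum Finset.univ fun j _ => unifTo_zero_of_norm_le (by
      have h := unifTo_bilin_zero (S := Icc 0 T) (innerSL ℝ) (w := fun q t x => R q t x j)
        (fun ε hε => by
          obtain ⟨N, hN⟩ := hR ε hε
          exact ⟨N, fun q hq t ht x => (norm_le_pi_norm (R q t x) j).trans (hN q hq t ht x)⟩)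
        (N₀ := 0) (fun q _ t ht x => hK₂ j t ht x)
      exact h)
  have hh := unifTo_congr hh₀ (fun q t _ x => rfl) (u' := fun _ _ => (0 : ℝ)) (fun t _ x => by simp)
  -- continuity of all lifts
  have hgc : ∀ q, ContinuousOn (FunctionSpaces.Torus.stLift fun t x => ⟪v q t x, FunctionSpaces.Torus.timeDeriv ψ t x⟫_ℝ +
      ⟪v q t x, ∑ i, v q t x i • FunctionSpaces.Torus.partialDeriv i (ψ t) x⟫_ℝ + p q t x * FunctionSpaces.Torus.divergence (ψ t) x)
      (Icc 0 T ×ˢ univ) := fun q => continuousOn_stLift_momentumIntegrand hT hψ (hvc q) (hpc q)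
  have hg₀c := continuousOn_stLift_momentumIntegrand hT hψ huc hPc
  have hhc : ∀ q, ContinuousOn (FunctionSpaces.Torus.stLift fun t x => ∑ j, ⟪R q t x j, FunctionSpaces.Torus.partialDeriv j (ψ t) x⟫_ℝ)
      (Icc 0 T ×ˢ univ) := fun q =>
    continuousOn_stLift_sum Finset.univ fun j _ =>
      FunctionSpaces.Torus.continuousOn_stLift_comp₂ (continuousOn_stLift_column (hRc q) j)
        ((hDψ j).continuousOn_stLift) (Φ := fun a b => ⟪a, b⟫_ℝ) continuous_inner
  have hh₀c : ContinuousOn (FunctionSpaces.Torus.stLift fun (_ : ℝ) (_ : UnitAddTorus d) => (0 : ℝ)) (Icc 0 T ×ˢ univ) :=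
    continuousOn_const
  -- pass to the limit in the identity (written in coordinates)
  have hmom' : ∀ q, ∫ t in Ioo 0 T, ∫ x, (⟪v q t x, FunctionSpaces.Torus.timeDeriv ψ t x⟫_ℝ +
      ⟪v q t x, ∑ i, v q t x i • FunctionSpaces.Torus.partialDeriv i (ψ t) x⟫_ℝ + p q t x * FunctionSpaces.Torus.divergence (ψ t) x) =
      ∫ t in Ioo 0 T, ∫ x, ∑ j, ⟪R q t x j, FunctionSpaces.Torus.partialDeriv j (ψ t) x⟫_ℝ := fun q => by
    simpa only [hconv] using hmom q ψ hψ
  have hlim := integral_integral_eq_of_unifTo hT.le hgc hg₀c hhc hh₀c hg hh hmom'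
  simp only [integral_zero] at hlim
  simpa only [hconv] using hlim

omit [DecidableEq d] in
/-- **Weak incompressibility passes to uniform limits**: if each `v_q(t)` is weakly divergence
free and `v_q → u` uniformly on `[0,T] × T^d` (all lifts continuous), then `u(t)` is weakly
divergence free for every `t ∈ [0,T]` (BDSV 2019, §2.2; De Lellis–Kwon 2022, §2.2). [cite: DelellisKwon2022, §2.2] -/
theorem isWeaklyDivFree_of_unifLimit {T : ℝ}
    {v : ℕ → ℝ → UnitAddTorus d → EuclideanSpace ℝ d} {u : ℝ → UnitAddTorus d → EuclideanSpace ℝ d}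
    (hvc : ∀ q, ContinuousOn (FunctionSpaces.Torus.stLift (v q)) (Icc 0 T ×ˢ univ))
    (hdiv : ∀ q, ∀ t ∈ Icc 0 T, FunctionSpaces.Torus.IsWeaklyDivFree (v q t))
    (hv : ∀ ε > (0 : ℝ), ∃ N : ℕ, ∀ q ≥ N, ∀ t ∈ Icc 0 T, ∀ x, ‖v q t x - u t x‖ ≤ ε)
    {t : ℝ} (ht : t ∈ Icc 0 T) : FunctionSpaces.Torus.IsWeaklyDivFree (u t) := by
  have huc : ContinuousOn (FunctionSpaces.Torus.stLift u) (Icc 0 T ×ˢ univ) := continuousOn_stLift_of_unifLimit hvc hv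
  intro θ hθ
  have hgc : Continuous (FunctionSpaces.Torus.gradient θ) := hθ.gradient.continuous
  obtain ⟨Kθ, hKθ⟩ := isCompact_univ.exists_bound_of_continuousOn hgc.continuousOn
  have hKθ' : ∀ x, ‖FunctionSpaces.Torus.gradient θ x‖ ≤ Kθ := fun x => hKθ x (mem_univ x)
  have hut : Continuous (u t) := FunctionSpaces.Torus.continuous_slice_of_continuousOn_stLift huc ht
  have hiu : Integrable (fun x => ⟪u t x, FunctionSpaces.Torus.gradient θ x⟫_ℝ) volume :=
    (hut.inner hgc).integrable_unitAddTorus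
  refine norm_le_zero_iff.1 (le_of_forall_pos_le_add fun ε hε => ?_)
  rw [zero_add]
  obtain ⟨N, hN⟩ := hv (ε / (Kθ + 1)) (div_pos hε (by linarith [(norm_nonneg _).trans (hKθ' 0)]))
  have hvt : Continuous (v N t) := FunctionSpaces.Torus.continuous_slice_of_continuousOn_stLift (hvc N) ht
  have hiv : Integrable (fun x => ⟪v N t x, FunctionSpaces.Torus.gradient θ x⟫_ℝ) volume :=
    (hvt.inner hgc).integrable_unitAddTorus
  have h0 : ∫ x, ⟪v N t x, FunctionSpaces.Torus.gradient θ x⟫_ℝ = 0 := hdiv N t ht θ hθ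
  have hsub : ∫ x, ⟪u t x, FunctionSpaces.Torus.gradient θ x⟫_ℝ = ∫ x, ⟪u t x - v N t x, FunctionSpaces.Torus.gradient θ x⟫_ℝ := by
    simp_rw [inner_sub_left]
    rw [integral_sub hiu hiv, h0, sub_zero]
  rw [hsub]
  have hK0 : 0 ≤ Kθ := (norm_nonneg _).trans (hKθ' 0)
  calc ‖∫ x, ⟪u t x - v N t x, FunctionSpaces.Torus.gradient θ x⟫_ℝ‖
      ≤ (ε / (Kθ + 1) * Kθ) * (volume : Measure (UnitAddTorus d)).real univ := by
        refine norm_integral_le_of_norm_le_const (ae_of_all _ fun x => ?_)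
        calc ‖⟪u t x - v N t x, FunctionSpaces.Torus.gradient θ x⟫_ℝ‖
            ≤ ‖u t x - v N t x‖ * ‖FunctionSpaces.Torus.gradient θ x‖ := norm_inner_le_norm _ _
          _ ≤ ε / (Kθ + 1) * Kθ := by
              refine mul_le_mul ?_ (hKθ' x) (norm_nonneg _) (div_pos hε (by linarith)).le
              rw [norm_sub_rev]
              exact hN N le_rfl t ht x
    _ = ε / (Kθ + 1) * Kθ := by simp
    _ ≤ ε := by
        rw [div_mul_eq_mul_div, div_le_iff₀ (by linarith)]
        nlinarith

end Literature.Analysis.FluidPDE.Torus
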